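import Summits.BirchSwinnertonDyer.BirchSwinnertonDyer.Theorems.ManinLocalTwoThreeDyadicCoreBinders
import HarnessLib

/-!
# The `c₄/c₆` criterion for a GOOD dyadic twist at `2`: `ord₂ c₄ ≥ 6 ∧ ord₂ c₆ = 6 ⟹ W ⊗ (±2)` good, `ord₂ c₄ ≥ 8 ∧ ord₂ c₆ = 9 ⟹
# W` or `W ⊗ (−1)` good; and a good dyadic twist forces `ord₂ j ∈ {0} ∪ [12, ∞)` (route `ManinLocalTwoThree`, crux C2 `ManinOddAtFour`
# stmt-BirchSwinnertonDyer-22967; cell bsd-f2-manin, p2 gen 16)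

E-blind local structure at `2` for the C2 core binder «no dyadic twist `W ⊗ d`, `d ∈ {−1, 2, −2}`, is `2`-semistable» of
`maninOddAtFour_of_core` (p705358) — the part of the core NOT visible to Kodaira symbols: inside the row `II`, `ord₂ Δ_min = 6`
(`f₂ = 6`) the classes with `ord₂ j ≥ 12` are twists of good SUPERSINGULAR curves (census N ≤ 5·10⁵, TWISTCENSUS2: 7 042 of the
29 657 classes of that row; the other 22 615, `ord₂ j ∈ {6, 9}`, have both `±2`-twists of type `I₃*`/`III*`, `f₂ = 5`).
* §0 valuation bookkeeping at `v ∋ 2` (`ord₂(2ⁿ m)`, residues `x ≡ ±2ᵏ (mod 2ᵏ⁺²)` for `ord₂ x = k ∈ {6, 9}`).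
* §1 KRAUS'S RECIPE, constructive instance `c₆ ≡ 8 (mod 32)`: `(2; −d b₂/12, 0, 4) • W^{(d)} = [0, 0, 1, −d²c₄/768, −(d³c₆ + 13824)/55296]`
  with discriminant `d⁶Δ/2¹²`; integral with unit discriminant under `ord₂(d²c₄) ≥ 8`, `ord₂(d³c₆ + 13824) ≥ 11`, `ord₂(d⁶Δ) = 12`.
* §2 THEOREM A `exists_hasGoodReductionAt_dyadicTwist_of_valuation_c₄_le_six_of_valuation_c₆_eq_six`: `ord₂ c₄ ≥ 6 ∧ ord₂ c₆ = 6`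
  (any model) ⟹ `W ⊗ d` GOOD at `2` for the `d ∈ {2, −2}` with `c₆ ≡ 32 d (mod 256)`.
* §3 THEOREM A′: `ord₂ c₄ ≥ 8 ∧ ord₂ c₆ = 9` ⟹ `W^{(d)}` GOOD for the `d ∈ {1, −1}` with `c₆ ≡ 2⁹ d (mod 2¹¹)`; if `W` is not good at `2`
  (e.g. minimal with `ord₂ Δ = 12`) then `W ⊗ (−1)` is good.
* §4 THEOREM B (`j` half): a quadratic twist good at `2` forces `|j|₂ = 1` or `|j|₂ ≤ 2⁻¹²` (parities of `a₁`, `a₃` on a global minimal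
  model: `a₁` odd ⟹ `c₄` odd; `a₁` even ⟹ `16 ∣ c₄`), a multiplicative one forces `|j|₂ > 1`.
The sequel `…DyadicTwistDictionary` assembles the E-blind dictionary «some dyadic twist `2`-semistable ⟺ `ord₂ j ≤ 0` ∨ (`ord₂ j ≥ 12` ∧
`ord₂ Δ_min ∈ {6, 12}`)».  HONEST FRAMING: local bookkeeping in print (Kraus 1989 Prop. 2; Silverman AEC VII.5.1, X.5.4; Barrios et al.
2025 Thm. 5.1 row `I₀`), kernel-checked; nothing about BSD, Manin's conjecture or C2 is proved; C2 OPEN on the core.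
[cite: Kraus1989, Prop. 2] [cite: SilvermanAEC2009, III.1 Table 3.1, VII.1 Remark 1.1, VII.5 Prop. 5.1, VIII.8.3, X.5 Cor. 5.4]
[cite: BarriosEtAl2025, Thm. 5.1 rows I₀ (arXiv:2501.03209 pp. 15–16)]
-/

set_option autoImplicit false
-- lint-debt: the directory name repeats the summit name (sibling precedent `ManinLocalTwoThreeDyadicCoreBinders.lean`)
set_option linter.dupNamespace false

noncomputable section

open scoped Classical NumberField
open WeierstrassCurve IsDedekindDomain IsDedekindDomain.HeightOneSpectrum Rat.HeightOneSpectrum WithZero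
  Literature.NumberTheory.DiophantineGeometry Literature.NumberTheory.EllipticCurves
  Literature.NumberTheory.GaloisRepresentations

namespace Summit.BirchSwinnertonDyer.BirchSwinnertonDyer.Theorems.ManinLocalTwoThree

variable {v : HeightOneSpectrum (𝓞 ℚ)}

/-! ## §0 Valuation bookkeeping at a place `v ∋ 2` of `ℚ` -/

/-- `ord₂(2ⁿ) = n` at a place `v ∋ 2` of `ℚ`. [folklore] -/
theorem valuation_two_pow_of_two_mem (hv : (2 : 𝓞 ℚ) ∈ v.asIdeal) (n : ℕ) :
    v.valuation ℚ ((2 : ℚ) ^ n) = exp (-(n : ℤ)) := by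
  rw [Valuation.map_pow, Rat.valuation_two_of_two_mem hv, ← exp_nsmul]
  simp

/-- An odd integer is a unit at a place `v ∋ 2` of `ℚ`. [folklore] -/
theorem valuation_intCast_eq_one_of_odd (hv : (2 : 𝓞 ℚ) ∈ v.asIdeal) {m : ℤ} (hm : ¬ (2 : ℤ) ∣ m) :
    v.valuation ℚ (m : ℚ) = 1 :=
  Rat.valuation_intCast_eq_one v (by rw [Rat.natGenerator_eq_two hv]; exact_mod_cast hm)

/-- `ord₂(2ⁿ·m) = n` for `m` odd, at a place `v ∋ 2` of `ℚ`. [folklore] -/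
theorem valuation_two_pow_mul_odd (hv : (2 : 𝓞 ℚ) ∈ v.asIdeal) (n : ℕ) {m : ℤ} (hm : ¬ (2 : ℤ) ∣ m) :
    v.valuation ℚ ((2 : ℚ) ^ n * m) = exp (-(n : ℤ)) := by
  rw [Valuation.map_mul, valuation_two_pow_of_two_mem hv, valuation_intCast_eq_one_of_odd hv hm, mul_one]

/-- At `v ∋ 2`: a rational of exact order `6` is `≡ 64` or `≡ −64 (mod 256)` (from the tree's `mod 32` version for
order `3`, `Rat.valuation_sub_eight_le_or_of_valuation_eq`, applied to `x/8`). [folklore] -/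
theorem valuation_sub_sixtyFour_le_or (hv : (2 : 𝓞 ℚ) ∈ v.asIdeal) {x : ℚ} (hx : v.valuation ℚ x = exp (-6 : ℤ)) :
    v.valuation ℚ (x - 64) ≤ exp (-8 : ℤ) ∨ v.valuation ℚ (x + 64) ≤ exp (-8 : ℤ) := by
  have h8 : v.valuation ℚ (8 : ℚ) = exp (-3 : ℤ) := by
    rw [show (8 : ℚ) = 2 ^ 3 by norm_num]; exact valuation_two_pow_of_two_mem hv 3
  have hx' : v.valuation ℚ (x / 8) = exp (-3 : ℤ) := by
    rw [map_div₀, hx, h8, ← exp_sub]; norm_num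
  have key : ∀ {y : ℚ}, v.valuation ℚ y ≤ exp (-5 : ℤ) → v.valuation ℚ (8 * y) ≤ exp (-8 : ℤ) := by
    intro y hy
    rw [Valuation.map_mul, h8, show (-8 : ℤ) = -3 + -5 by norm_num, exp_add]
    exact mul_le_mul' le_rfl hy
  rcases Rat.valuation_sub_eight_le_or_of_valuation_eq hv hx' with h | h
  · left
    rw [show x - 64 = 8 * (x / 8 - 8) by ring]
    exact key h
  · right
    rw [show x + 64 = 8 * (x / 8 + 8) by ring]
    exact key h

/-- At `v ∋ 2`: a rational of exact order `9` is `≡ 2⁹` or `≡ −2⁹ (mod 2¹¹)`. [folklore] -/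
theorem valuation_sub_pow_nine_le_or (hv : (2 : 𝓞 ℚ) ∈ v.asIdeal) {x : ℚ} (hx : v.valuation ℚ x = exp (-9 : ℤ)) :
    v.valuation ℚ (x - 512) ≤ exp (-11 : ℤ) ∨ v.valuation ℚ (x + 512) ≤ exp (-11 : ℤ) := by
  have h64 : v.valuation ℚ (64 : ℚ) = exp (-6 : ℤ) := by
    rw [show (64 : ℚ) = 2 ^ 6 by norm_num]; exact valuation_two_pow_of_two_mem hv 6
  have hx' : v.valuation ℚ (x / 64) = exp (-3 : ℤ) := by
    rw [map_div₀, hx, h64, ← exp_sub]; norm_num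
  have key : ∀ {y : ℚ}, v.valuation ℚ y ≤ exp (-5 : ℤ) → v.valuation ℚ (64 * y) ≤ exp (-11 : ℤ) := by
    intro y hy
    rw [Valuation.map_mul, h64, show (-11 : ℤ) = -6 + -5 by norm_num, exp_add]
    exact mul_le_mul' le_rfl hy
  rcases Rat.valuation_sub_eight_le_or_of_valuation_eq hv hx' with h | h
  · left
    rw [show x - 512 = 64 * (x / 64 - 8) by ring]
    exact key h
  · right
    rw [show x + 512 = 64 * (x / 64 + 8) by ring]
    exact key h

/-! ## §1 The descent model `(2; −d b₂/12, 0, 4) • W^{(d)} = [0, 0, 1, −d²c₄/768, −(d³c₆ + 13824)/55296]` -/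

/-- **Kraus's integrality recipe at `2`, constructive instance `c₆ ≡ 8 (mod 32)`.**  For every `W/ℚ` and `d`, the change of
variables `(u; r, s, t) = (2; −d·b₂/12, 0, 4)` takes the twist model `W^{(d)} = [0, d b₂/4, 0, d² b₄/2, d³ b₆/4]` to
`[0, 0, 1, −d² c₄/768, −(d³ c₆ + 13824)/55296]`, of discriminant `d⁶ Δ/2¹²` (`768 = 2⁸·3`, `13824 = 2⁹·27`, `55296 = 2¹¹·27`):
the model `y² + y = x³ − (C₄/48) x − (C₆ + 216)/864` with invariants `(C₄, C₆) = (d²c₄/2⁴, d³c₆/2⁶)`, which is `2`-integral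
exactly when `16 ∣ C₄` and `C₆ ≡ 8 (mod 32)` (Kraus 1989 Prop. 2, second alternative). [cite: Kraus1989, Prop. 2]
[cite: SilvermanAEC2009, III.1 Table 3.1] -/
theorem descentChange_smul_quadraticTwist (W : WeierstrassCurve ℚ) (d : ℚ) :
    ((⟨Units.mk0 (2 : ℚ) two_ne_zero, -(d * W.b₂) / 12, 0, 4⟩ : VariableChange ℚ) • W.quadraticTwist d).a₁ = 0 ∧
    ((⟨Units.mk0 (2 : ℚ) two_ne_zero, -(d * W.b₂) / 12, 0, 4⟩ : VariableChange ℚ) • W.quadraticTwist d).a₂ = 0 ∧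
    ((⟨Units.mk0 (2 : ℚ) two_ne_zero, -(d * W.b₂) / 12, 0, 4⟩ : VariableChange ℚ) • W.quadraticTwist d).a₃ = 1 ∧
    ((⟨Units.mk0 (2 : ℚ) two_ne_zero, -(d * W.b₂) / 12, 0, 4⟩ : VariableChange ℚ) • W.quadraticTwist d).a₄ =
      -(d ^ 2 * W.c₄) / 768 ∧
    ((⟨Units.mk0 (2 : ℚ) two_ne_zero, -(d * W.b₂) / 12, 0, 4⟩ : VariableChange ℚ) • W.quadraticTwist d).a₆ =
      -(d ^ 3 * W.c₆ + 13824) / 55296 ∧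
    ((⟨Units.mk0 (2 : ℚ) two_ne_zero, -(d * W.b₂) / 12, 0, 4⟩ : VariableChange ℚ) • W.quadraticTwist d).Δ =
      d ^ 6 * W.Δ / 4096 := by
  refine ⟨?_, ?_, ?_, ?_, ?_, ?_⟩
  · simp [variableChange_a₁, quadraticTwist_a₁]
  · rw [variableChange_a₂, quadraticTwist_a₁, quadraticTwist_a₂]
    simp only [Units.val_inv_eq_inv_val, Units.val_mk0]
    ring
  · rw [variableChange_a₃, quadraticTwist_a₁, quadraticTwist_a₃]
    simp only [Units.val_inv_eq_inv_val, Units.val_mk0]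
    norm_num
  · rw [variableChange_a₄, quadraticTwist_a₁, quadraticTwist_a₂, quadraticTwist_a₃, quadraticTwist_a₄]
    simp only [Units.val_inv_eq_inv_val, Units.val_mk0, WeierstrassCurve.c₄]
    ring
  · rw [variableChange_a₆, quadraticTwist_a₁, quadraticTwist_a₂, quadraticTwist_a₃, quadraticTwist_a₄, quadraticTwist_a₆]
    simp only [Units.val_inv_eq_inv_val, Units.val_mk0, WeierstrassCurve.c₆]
    ring
  · rw [variableChange_Δ, quadraticTwist_Δ]
    simp only [Units.val_inv_eq_inv_val, Units.val_mk0]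
    ring

/-- **Good reduction of the twist `W^{(d)}` at `2` from the descent model**: if `ord₂(d² c₄) ≥ 8`, `ord₂(d³ c₆ + 13824) ≥ 11` and
`ord₂(d⁶ Δ) = 12`, then `W^{(d)}` has a `2`-integral model with unit discriminant, hence GOOD reduction at `v ∋ 2`.
[cite: Kraus1989, Prop. 2] [cite: SilvermanAEC2009, VII.1 Remark 1.1, VII.5 Prop. 5.1(a)] -/
theorem hasGoodReductionAt_quadraticTwist_of_valuation_descent (hv : (2 : 𝓞 ℚ) ∈ v.asIdeal) (W : WeierstrassCurve ℚ) {d : ℚ}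
    (h4 : v.valuation ℚ (d ^ 2 * W.c₄) ≤ exp (-8 : ℤ)) (h6 : v.valuation ℚ (d ^ 3 * W.c₆ + 13824) ≤ exp (-11 : ℤ))
    (hΔ : v.valuation ℚ (d ^ 6 * W.Δ) = exp (-12 : ℤ)) :
    (W.quadraticTwist d).HasGoodReductionAt v := by
  set C : VariableChange ℚ := ⟨Units.mk0 (2 : ℚ) two_ne_zero, -(d * W.b₂) / 12, 0, 4⟩ with hC
  obtain ⟨h₁, h₂, h₃, h₄', h₆', hΔ'⟩ := descentChange_smul_quadraticTwist W d
  rw [← hC] at h₁ h₂ h₃ h₄' h₆' hΔ'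
  have h768 : v.valuation ℚ (768 : ℚ) = exp (-8 : ℤ) := by
    rw [show (768 : ℚ) = 2 ^ 8 * ((3 : ℤ) : ℚ) by norm_num]; exact valuation_two_pow_mul_odd hv 8 (by decide)
  have h55296 : v.valuation ℚ (55296 : ℚ) = exp (-11 : ℤ) := by
    rw [show (55296 : ℚ) = 2 ^ 11 * ((27 : ℤ) : ℚ) by norm_num]; exact valuation_two_pow_mul_odd hv 11 (by decide)
  have h4096 : v.valuation ℚ (4096 : ℚ) = exp (-12 : ℤ) := by
    rw [show (4096 : ℚ) = 2 ^ 12 by norm_num]; exact valuation_two_pow_of_two_mem hv 12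
  have hgood : (C • W.quadraticTwist d).HasGoodReductionAt v := by
    refine hasGoodReductionAt_of_valuation_le_one_of_valuation_Δ_eq_one v _ ?_ ?_ ?_ ?_ ?_ ?_
    · rw [h₁, Valuation.map_zero]; exact zero_le
    · rw [h₂, Valuation.map_zero]; exact zero_le
    · rw [h₃, Valuation.map_one]
    · rw [h₄', map_div₀, Valuation.map_neg, h768, div_le_one₀ (zero_lt_iff.mpr exp_ne_zero)]
      exact h4
    · rw [h₆', map_div₀, Valuation.map_neg, h55296, div_le_one₀ (zero_lt_iff.mpr exp_ne_zero)]
      exact h6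
    · rw [hΔ', map_div₀, hΔ, h4096, div_self exp_ne_zero]
  exact (hasGoodReductionAt_smul_iff_holds v (W.quadraticTwist d) C).mp hgood

/-! ## §2 THEOREM A: `ord₂ c₄ ≥ 6 ∧ ord₂ c₆ = 6` ⟹ `W ⊗ 2` or `W ⊗ (−2)` has GOOD reduction at `2` -/

/-- `ord₂ Δ = 6` from `ord₂ c₄ ≥ 6`, `ord₂ c₆ = 6` (`1728 Δ = c₄³ − c₆²`). [cite: SilvermanAEC2009, III.1] -/
theorem valuation_Δ_eq_of_valuation_c₄_le_six_of_valuation_c₆_eq_six (hv : (2 : 𝓞 ℚ) ∈ v.asIdeal) (W : WeierstrassCurve ℚ)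
    (h4 : v.valuation ℚ W.c₄ ≤ exp (-6 : ℤ)) (h6 : v.valuation ℚ W.c₆ = exp (-6 : ℤ)) :
    v.valuation ℚ W.Δ = exp (-6 : ℤ) := by
  have h1728 : v.valuation ℚ (1728 : ℚ) = exp (-6 : ℤ) := by
    rw [show (1728 : ℚ) = 2 ^ 6 * ((27 : ℤ) : ℚ) by norm_num]; exact valuation_two_pow_mul_odd hv 6 (by decide)
  have hc₆ : v.valuation ℚ (W.c₆ ^ 2) = exp (-12 : ℤ) := by
    rw [Valuation.map_pow, h6, ← exp_nsmul]; norm_num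
  have hc₄ : v.valuation ℚ (W.c₄ ^ 3) < v.valuation ℚ (W.c₆ ^ 2) := by
    rw [hc₆, Valuation.map_pow]
    calc v.valuation ℚ W.c₄ ^ 3 ≤ exp (-6 : ℤ) ^ 3 := pow_le_pow_left' h4 3
      _ < exp (-12 : ℤ) := by rw [← exp_nsmul, exp_lt_exp]; norm_num
  have hrel : v.valuation ℚ (W.c₄ ^ 3 - W.c₆ ^ 2) = exp (-12 : ℤ) := by
    rw [Valuation.map_sub_eq_of_lt_right _ hc₄]
    exact hc₆
  have := W.c_relation
  have hΔ : W.Δ = (W.c₄ ^ 3 - W.c₆ ^ 2) / 1728 := by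
    rw [← this]; ring
  rw [hΔ, map_div₀, hrel, h1728, ← exp_sub]; norm_num

/-- `ord₂ Δ = 12` from `ord₂ c₄ ≥ 8`, `ord₂ c₆ = 9` (`1728 Δ = c₄³ − c₆²`). [cite: SilvermanAEC2009, III.1] -/
theorem valuation_Δ_eq_of_valuation_c₄_le_eight_of_valuation_c₆_eq_nine (hv : (2 : 𝓞 ℚ) ∈ v.asIdeal) (W : WeierstrassCurve ℚ)
    (h4 : v.valuation ℚ W.c₄ ≤ exp (-8 : ℤ)) (h6 : v.valuation ℚ W.c₆ = exp (-9 : ℤ)) :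
    v.valuation ℚ W.Δ = exp (-12 : ℤ) := by
  have h1728 : v.valuation ℚ (1728 : ℚ) = exp (-6 : ℤ) := by
    rw [show (1728 : ℚ) = 2 ^ 6 * ((27 : ℤ) : ℚ) by norm_num]; exact valuation_two_pow_mul_odd hv 6 (by decide)
  have hc₆ : v.valuation ℚ (W.c₆ ^ 2) = exp (-18 : ℤ) := by
    rw [Valuation.map_pow, h6, ← exp_nsmul]; norm_num
  have hc₄ : v.valuation ℚ (W.c₄ ^ 3) < v.valuation ℚ (W.c₆ ^ 2) := by
    rw [hc₆, Valuation.map_pow]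
    calc v.valuation ℚ W.c₄ ^ 3 ≤ exp (-8 : ℤ) ^ 3 := pow_le_pow_left' h4 3
      _ < exp (-18 : ℤ) := by rw [← exp_nsmul, exp_lt_exp]; norm_num
  have hrel : v.valuation ℚ (W.c₄ ^ 3 - W.c₆ ^ 2) = exp (-18 : ℤ) := by
    rw [Valuation.map_sub_eq_of_lt_right _ hc₄]
    exact hc₆
  have hΔ : W.Δ = (W.c₄ ^ 3 - W.c₆ ^ 2) / 1728 := by
    rw [← W.c_relation]; ring
  rw [hΔ, map_div₀, hrel, h1728, ← exp_sub]; norm_num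

/-- If `ord₂(x − y) > ord₂ y = n` then `ord₂ x = n`. [folklore] -/
theorem valuation_eq_of_valuation_sub_lt {x y : ℚ} {n : ℤ} (hy : v.valuation ℚ y = exp n)
    (h : v.valuation ℚ (x - y) < exp n) : v.valuation ℚ x = exp n := by
  rw [show x = x - y + y by ring, Valuation.map_add_eq_of_lt_right _ (by rwa [hy]), hy]

/-- **THEOREM A, explicit sign.**  `ord₂ c₄(W) ≥ 6` and `c₆(W) ≡ 32 d (mod 2⁸)` with `d = ±2` (so `ord₂ c₆ = 6`) ⟹ the twist
`W ⊗ d = W^{(d)}` has GOOD reduction at `2`: the descent model of §1 has `a₄ = −c₄/192`, `a₆ = −(4d(c₆ − 32d) + 14336)/55296`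
(`14336 = 7·2¹¹`) and discriminant `Δ/64`, a `2`-adic unit.  (These `W` are the twists by `χ_{±2}`/`χ_{±6}` of the curves with
good SUPERSINGULAR reduction at `2`; any model of `W` may be used — the hypothesis is not a minimality condition.)
[cite: Kraus1989, Prop. 2] [cite: SilvermanAEC2009, VII.5 Prop. 5.1(a), X.5 Cor. 5.4] -/
theorem hasGoodReductionAt_quadraticTwist_of_valuation_c₆_sub_le_eight (hv : (2 : 𝓞 ℚ) ∈ v.asIdeal) (W : WeierstrassCurve ℚ)
    {d : ℤ} (hd : d = 2 ∨ d = -2) (h4 : v.valuation ℚ W.c₄ ≤ exp (-6 : ℤ))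
    (h6d : v.valuation ℚ (W.c₆ - 32 * d) ≤ exp (-8 : ℤ)) :
    (W.quadraticTwist (d : ℚ)).HasGoodReductionAt v := by
  have h2 := Rat.valuation_two_of_two_mem hv
  have hd2 : ((d : ℚ)) ^ 2 = 4 := by rcases hd with rfl | rfl <;> norm_num
  have hvd : v.valuation ℚ (d : ℚ) = exp (-1 : ℤ) := by
    rcases hd with rfl | rfl
    · simpa using h2
    · rw [show ((-2 : ℤ) : ℚ) = -2 by norm_num, Valuation.map_neg]; exact h2
  have h4q : v.valuation ℚ (4 : ℚ) = exp (-2 : ℤ) := by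
    rw [show (4 : ℚ) = 2 ^ 2 by norm_num]; exact valuation_two_pow_of_two_mem hv 2
  have h32d : v.valuation ℚ (32 * (d : ℚ)) = exp (-6 : ℤ) := by
    rw [Valuation.map_mul, show (32 : ℚ) = 2 ^ 5 by norm_num, valuation_two_pow_of_two_mem hv 5, hvd, ← exp_add]
    norm_num
  have h6 : v.valuation ℚ W.c₆ = exp (-6 : ℤ) :=
    valuation_eq_of_valuation_sub_lt h32d (lt_of_le_of_lt h6d (by rw [exp_lt_exp]; norm_num))
  have hΔ := valuation_Δ_eq_of_valuation_c₄_le_six_of_valuation_c₆_eq_six hv W h4 h6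
  refine hasGoodReductionAt_quadraticTwist_of_valuation_descent hv W ?_ ?_ ?_
  · rw [hd2, Valuation.map_mul, h4q, show (-8 : ℤ) = -2 + -6 by norm_num, exp_add]
    exact mul_le_mul' le_rfl h4
  · have hid : (d : ℚ) ^ 3 * W.c₆ + 13824 = 4 * d * (W.c₆ - 32 * d) + 14336 := by
      linear_combination ((d : ℚ) * W.c₆ + 128) * hd2
    have h14336 : v.valuation ℚ (14336 : ℚ) = exp (-11 : ℤ) := by
      rw [show (14336 : ℚ) = 2 ^ 11 * ((7 : ℤ) : ℚ) by norm_num]; exact valuation_two_pow_mul_odd hv 11 (by decide)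
    rw [hid]
    refine Valuation.map_add_le _ ?_ h14336.le
    rw [Valuation.map_mul, Valuation.map_mul, h4q, hvd, show (-11 : ℤ) = (-2 + -1) + -8 by norm_num, exp_add, exp_add]
    exact mul_le_mul' le_rfl h6d
  · rw [Valuation.map_mul, Valuation.map_pow, hvd, hΔ, ← exp_nsmul, ← exp_add]
    norm_num

/-- **THEOREM A.**  `ord₂ c₄(W) ≥ 6 ∧ ord₂ c₆(W) = 6` (on ANY model of `W/ℚ`) ⟹ `W ⊗ 2` or `W ⊗ (−2)` has GOOD reduction at `2`
(the sign is `c₆/64 mod 4`).  For a globally minimal `W` this is the stratum `ord₂ Δ_min = 6 ∧ ord₂ j ≥ 12` of the C2 census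
(Kodaira `II`, `f₂ = 6`), which is therefore TWIST-COVERED — the complement, inside `ord₂ Δ_min = 6`, of the core rows with
`ord₂ j ∈ {6, 9}`.  [cite: Kraus1989, Prop. 2] [cite: SilvermanAEC2009, VII.5 Prop. 5.1(a), X.5 Cor. 5.4]
[cite: SilvermanATAEC1994, IV.9 Table 4.1] -/
theorem exists_hasGoodReductionAt_dyadicTwist_of_valuation_c₄_le_six_of_valuation_c₆_eq_six (hv : (2 : 𝓞 ℚ) ∈ v.asIdeal)
    (W : WeierstrassCurve ℚ) (h4 : v.valuation ℚ W.c₄ ≤ exp (-6 : ℤ)) (h6 : v.valuation ℚ W.c₆ = exp (-6 : ℤ)) :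
    ∃ d : ℤ, (d = 2 ∨ d = -2) ∧ (W.quadraticTwist (d : ℚ)).HasGoodReductionAt v := by
  rcases valuation_sub_sixtyFour_le_or hv h6 with h | h
  · exact ⟨2, Or.inl rfl, hasGoodReductionAt_quadraticTwist_of_valuation_c₆_sub_le_eight hv W (Or.inl rfl) h4
      (by rw [show W.c₆ - (32 : ℚ) * ((2 : ℤ) : ℚ) = W.c₆ - 64 by push_cast; ring]; exact h)⟩
  · exact ⟨-2, Or.inr rfl, hasGoodReductionAt_quadraticTwist_of_valuation_c₆_sub_le_eight hv W (Or.inr rfl) h4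
      (by rw [show W.c₆ - (32 : ℚ) * ((-2 : ℤ) : ℚ) = W.c₆ + 64 by push_cast; ring]; exact h)⟩

/-! ## §3 THEOREM A′: `ord₂ c₄ ≥ 8 ∧ ord₂ c₆ = 9` ⟹ `W` or `W ⊗ (−1)` has GOOD reduction at `2` -/

/-- **THEOREM A′, explicit sign.**  `ord₂ c₄(W) ≥ 8` and `c₆(W) ≡ 2⁹ d (mod 2¹¹)` with `d = ±1` ⟹ `W^{(d)}` has GOOD reduction at
`2` (descent model `a₄ = −c₄/768`, `a₆ = −(d(c₆ − 512d) + 14336)/55296`, `Δ/2¹²` a unit).  These are the twists by `χ₋₁`/`χ₃`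
(`d = −1`) of the good supersingular curves, resp. (`d = 1`) the non-minimal equations of good supersingular curves themselves.
[cite: Kraus1989, Prop. 2] [cite: SilvermanAEC2009, VII.5 Prop. 5.1(a), X.5 Cor. 5.4] -/
theorem hasGoodReductionAt_quadraticTwist_of_valuation_c₆_sub_le_eleven (hv : (2 : 𝓞 ℚ) ∈ v.asIdeal) (W : WeierstrassCurve ℚ)
    {d : ℤ} (hd : d = 1 ∨ d = -1) (h4 : v.valuation ℚ W.c₄ ≤ exp (-8 : ℤ))
    (h6d : v.valuation ℚ (W.c₆ - 512 * d) ≤ exp (-11 : ℤ)) :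
    (W.quadraticTwist (d : ℚ)).HasGoodReductionAt v := by
  have hd2 : ((d : ℚ)) ^ 2 = 1 := by rcases hd with rfl | rfl <;> norm_num
  have hvd : v.valuation ℚ (d : ℚ) = 1 := by
    rcases hd with rfl | rfl
    · simp
    · rw [show ((-1 : ℤ) : ℚ) = -1 by norm_num, Valuation.map_neg, Valuation.map_one]
  have h512d : v.valuation ℚ (512 * (d : ℚ)) = exp (-9 : ℤ) := by
    rw [Valuation.map_mul, show (512 : ℚ) = 2 ^ 9 by norm_num, valuation_two_pow_of_two_mem hv 9, hvd, mul_one]; norm_num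
  have h6 : v.valuation ℚ W.c₆ = exp (-9 : ℤ) :=
    valuation_eq_of_valuation_sub_lt h512d (lt_of_le_of_lt h6d (by rw [exp_lt_exp]; norm_num))
  have hΔ := valuation_Δ_eq_of_valuation_c₄_le_eight_of_valuation_c₆_eq_nine hv W h4 h6
  refine hasGoodReductionAt_quadraticTwist_of_valuation_descent hv W ?_ ?_ ?_
  · rw [hd2, one_mul]; exact h4
  · have hid : (d : ℚ) ^ 3 * W.c₆ + 13824 = d * (W.c₆ - 512 * d) + 14336 := by
      linear_combination ((d : ℚ) * W.c₆ + 512) * hd2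
    have h14336 : v.valuation ℚ (14336 : ℚ) = exp (-11 : ℤ) := by
      rw [show (14336 : ℚ) = 2 ^ 11 * ((7 : ℤ) : ℚ) by norm_num]; exact valuation_two_pow_mul_odd hv 11 (by decide)
    rw [hid]
    refine Valuation.map_add_le _ ?_ h14336.le
    rw [Valuation.map_mul, hvd, one_mul]
    exact h6d
  · rw [Valuation.map_mul, Valuation.map_pow, hvd, one_pow, one_mul, hΔ]

/-- **THEOREM A′.**  `ord₂ c₄(W) ≥ 8 ∧ ord₂ c₆(W) = 9` (on ANY model) ⟹ `W^{(1)} (≅ W)` or `W ⊗ (−1)` has GOOD reduction at `2`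
(the sign is `c₆/2⁹ mod 4`).  For a globally minimal `W` — which is not good at `2`, since `ord₂ Δ = 12` — this is the stratum
`ord₂ Δ_min = 12 ∧ ord₂ j ≥ 12` (Kodaira `II*`, `f₂ = 4`: the `χ₋₄`-twists of the good supersingular curves), TWIST-COVERED by
`d = −1`.  [cite: Kraus1989, Prop. 2] [cite: SilvermanAEC2009, VII.5 Prop. 5.1(a), X.5 Cor. 5.4] -/
theorem exists_hasGoodReductionAt_unitTwist_of_valuation_c₄_le_eight_of_valuation_c₆_eq_nine (hv : (2 : 𝓞 ℚ) ∈ v.asIdeal)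
    (W : WeierstrassCurve ℚ) (h4 : v.valuation ℚ W.c₄ ≤ exp (-8 : ℤ)) (h6 : v.valuation ℚ W.c₆ = exp (-9 : ℤ)) :
    ∃ d : ℤ, (d = 1 ∨ d = -1) ∧ (W.quadraticTwist (d : ℚ)).HasGoodReductionAt v := by
  rcases valuation_sub_pow_nine_le_or hv h6 with h | h
  · exact ⟨1, Or.inl rfl, hasGoodReductionAt_quadraticTwist_of_valuation_c₆_sub_le_eleven hv W (Or.inl rfl) h4
      (by rw [show W.c₆ - (512 : ℚ) * ((1 : ℤ) : ℚ) = W.c₆ - 512 by push_cast; ring]; exact h)⟩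
  · exact ⟨-1, Or.inr rfl, hasGoodReductionAt_quadraticTwist_of_valuation_c₆_sub_le_eleven hv W (Or.inr rfl) h4
      (by rw [show W.c₆ - (512 : ℚ) * ((-1 : ℤ) : ℚ) = W.c₆ + 512 by push_cast; ring]; exact h)⟩

/-- **THEOREM A′ for a curve that is NOT good at `2`** (e.g. any globally minimal `W` with `ord₂ Δ = 12`, or any `W` additive at
`2`): `ord₂ c₄ ≥ 8 ∧ ord₂ c₆ = 9` ⟹ the `χ₋₄`-twist `W ⊗ (−1)` has GOOD reduction at `2` (`W^{(1)} ≅ W` by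
`exists_variableChange_quadraticTwist_one`, and good reduction is an isomorphism invariant). [cite: Kraus1989, Prop. 2]
[cite: SilvermanAEC2009, VII.5 Prop. 5.1(a), X.5 Cor. 5.4] -/
theorem hasGoodReductionAt_quadraticTwist_negOne_of_valuation_c₄_le_eight_of_valuation_c₆_eq_nine (hv : (2 : 𝓞 ℚ) ∈ v.asIdeal)
    (W : WeierstrassCurve ℚ) (hW : ¬ W.HasGoodReductionAt v)
    (h4 : v.valuation ℚ W.c₄ ≤ exp (-8 : ℤ)) (h6 : v.valuation ℚ W.c₆ = exp (-9 : ℤ)) :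
    (W.quadraticTwist ((-1 : ℤ) : ℚ)).HasGoodReductionAt v := by
  obtain ⟨d, hd, hgood⟩ := exists_hasGoodReductionAt_unitTwist_of_valuation_c₄_le_eight_of_valuation_c₆_eq_nine hv W h4 h6
  rcases hd with rfl | rfl
  · exfalso
    obtain ⟨C, hC⟩ := W.exists_variableChange_quadraticTwist_one
    refine hW ((hasGoodReductionAt_smul_iff_holds v W C).mp ?_)
    rw [hC]
    simpa using hgood
  · exact hgood

/-! ## §4 THEOREM B: a `2`-semistable dyadic twist forces `ord₂ j ≤ 0` or `ord₂ j ≥ 12` -/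

/-- `|j|_v = |c₄|_v³ / |Δ|_v`. [folklore] -/
theorem valuation_j_eq_valuation_c₄_pow_div (E : WeierstrassCurve ℚ) [E.IsElliptic] :
    v.valuation ℚ E.j = v.valuation ℚ E.c₄ ^ 3 / v.valuation ℚ E.Δ := by
  rw [WeierstrassCurve.j, Units.val_inv_eq_inv_val, WeierstrassCurve.coe_Δ', Valuation.map_mul, map_inv₀,
    Valuation.map_pow, inv_mul_eq_div]

/-- **A curve with GOOD reduction at `2` has `ord₂ j = 0` (ordinary: `a₁` odd, `c₄` odd) or `ord₂ j ≥ 12` (supersingular: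
`a₁` even, `16 ∣ c₄`)**, read on a global minimal model (`Δ` a `2`-adic unit). [cite: SilvermanAEC2009, VII.5 Prop. 5.1(a), VIII.8.3]
[cite: Kraus1989, Prop. 2] -/
theorem valuation_j_eq_one_or_le_of_hasGoodReductionAt_two (hv : (2 : 𝓞 ℚ) ∈ v.asIdeal) (E : WeierstrassCurve ℚ)
    [E.IsElliptic] (hgood : E.HasGoodReductionAt v) :
    v.valuation ℚ E.j = 1 ∨ v.valuation ℚ E.j ≤ exp (-12 : ℤ) := by
  obtain ⟨C, hC⟩ := WeierstrassCurve.hasGlobalMinimalModel_rat_holds E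
  haveI := hC
  have hgood' : (C • E).HasGoodReductionAt v := (hasGoodReductionAt_smul_iff_holds v E C).mpr hgood
  have hmin : (C • E).IsMinimalAt v := IsGloballyMinimal.isMinimal v
  have hΔ1 : v.valuation ℚ (C • E).Δ = 1 := (hasGoodReductionAt_iff_of_isMinimalAt hmin).mp hgood'
  set M := integralModelInt (C • E) with hM
  have hME : M.map (Int.castRingHom ℚ) = C • E := map_integralModelInt (C • E)
  have hc₄ : (C • E).c₄ = (M.c₄ : ℚ) := by rw [← hME, map_c₄, eq_intCast]
  have hvj : v.valuation ℚ E.j = v.valuation ℚ (M.c₄ : ℚ) ^ 3 := by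
    rw [← E.variableChange_j C, valuation_j_eq_valuation_c₄_pow_div, hΔ1, div_one, hc₄]
  rcases Int.even_or_odd M.a₁ with h₁ | h₁
  · right
    have h16 := sixteen_dvd_c₄_of_even_a₁ M h₁
    have hle : v.valuation ℚ (M.c₄ : ℚ) ≤ exp (-((4 : ℕ) : ℤ)) :=
      Rat.valuation_intCast_le v (by rw [Rat.natGenerator_eq_two hv]; simpa using h16)
    rw [hvj]
    calc v.valuation ℚ (M.c₄ : ℚ) ^ 3 ≤ exp (-((4 : ℕ) : ℤ)) ^ 3 := pow_le_pow_left' hle 3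
      _ = exp (-12 : ℤ) := by rw [← exp_nsmul]; norm_num
  · left
    rw [hvj, valuation_intCast_eq_one_of_odd hv (odd_c₄_of_odd_a₁ M h₁), one_pow]

/-- **A curve with MULTIPLICATIVE reduction at `v` has `|j|_v > 1`** (`c₄` a unit, `Δ` not, on a minimal model).
[cite: SilvermanAEC2009, VII.5 Prop. 5.1(b)] -/
theorem one_lt_valuation_j_of_hasMultiplicativeReductionAt_rat (E : WeierstrassCurve ℚ) [E.IsElliptic]
    (hm : E.HasMultiplicativeReductionAt v) : 1 < v.valuation ℚ E.j := by
  obtain ⟨C, hC⟩ := WeierstrassCurve.hasGlobalMinimalModel_rat_holds E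
  haveI := hC
  have hm' : (C • E).HasMultiplicativeReductionAt v := (hasMultiplicativeReductionAt_smul_iff_holds v E C).mpr hm
  have hmin : (C • E).IsMinimalAt v := IsGloballyMinimal.isMinimal v
  obtain ⟨hΔ, hc₄⟩ := (hasMultiplicativeReductionAt_iff_of_isMinimalAt hmin).mp hm'
  rw [← E.variableChange_j C, valuation_j_eq_valuation_c₄_pow_div, hc₄, one_pow]
  have h0 : v.valuation ℚ (C • E).Δ ≠ 0 := (Valuation.ne_zero_iff _).mpr (C • E).isUnit_Δ.ne_zero
  exact (one_lt_div₀ (zero_lt_iff.mpr h0)).mpr hΔ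

/-- **THEOREM B (`j` half).**  If some quadratic twist `W ⊗ d` (`d ≠ 0`) is SEMISTABLE at `2` then `ord₂ j(W) ≤ 0` or `ord₂ j(W) ≥ 12`:
multiplicative ⟹ `|j|₂ > 1`; good ⟹ `|j|₂ = 1` or `≤ 2⁻¹²` (§4); and `j(W ⊗ d) = j(W)`.
[cite: SilvermanAEC2009, VII.5 Prop. 5.1, X.5 Cor. 5.4] -/
theorem one_le_valuation_j_or_le_of_semistable_quadraticTwist (hv : (2 : 𝓞 ℚ) ∈ v.asIdeal) (W : WeierstrassCurve ℚ)
    [W.IsElliptic] {d : ℚ} (hd : d ≠ 0)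
    (hss : (W.quadraticTwist d).HasGoodReductionAt v ∨ (W.quadraticTwist d).HasMultiplicativeReductionAt v) :
    1 ≤ v.valuation ℚ W.j ∨ v.valuation ℚ W.j ≤ exp (-12 : ℤ) := by
  haveI := W.isElliptic_quadraticTwist hd
  rw [← W.j_quadraticTwist hd]
  rcases hss with h | h
  · rcases valuation_j_eq_one_or_le_of_hasGoodReductionAt_two hv _ h with h' | h'
    · exact Or.inl h'.ge
    · exact Or.inr h'
  · exact Or.inl (one_lt_valuation_j_of_hasMultiplicativeReductionAt_rat _ h).le

end Summit.BirchSwinnertonDyer.BirchSwinnertonDyer.Theorems.ManinLocalTwoThree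

end
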